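/-
Copyright (c) 2026 the pub-hodgecm-mathlib formalisation cell (harness21).  Prover seat hodgecm-mathlib-K2Liu-p26 (g2): Track B «K2-LIT»,
#184♮ = hLiu418 = stmt-HodgeConjecture-24832; #42F′ FACE-G, organ F4 (G-gen), road (E) «compact see-saw + FFT + PBW + `K_H`-averaging» (RULING M-158r∕M-158s,
F4 lead K2Liu-p27 (g2) ROAD VERDICT 23:03:11Z «(E-a1) `K2LiuUnitaryZariskiDensity` → K2Liu-p26»), brick (E-a1): THE UNITARIAN TRICK IN THE (E-a0) CURRENCY —
`U(p)`-invariant ⇒ `GL_p(ℂ)`-invariant for the substitution action `x ↦ x·g`, `y ↦ y·(g⁻¹)ᵀ` on `ℂ[x_{ia}, y_{ja}]`.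
-/
import Literature.RepresentationTheory.AlgebraicGroups.UnitaryZariskiDense    -- ★ `mvPolynomial_eq_zero_of_eval_unitaryGroup` (U(n) Zariski dense in M_n(ℂ))
import Summits.HodgeConjecture.HodgeConjecture.Theorems.K2LiuUnitaryPolySubstDefs    -- ★ (E-a0) `polySubst`, `substFun`, `IsGLInvariant`, `IsUnitaryInvariant`
import HarnessLib

/-!
# Crux `HLiu418`, organ F4 (G-gen), road (E), brick (E-a1): `U(n)` IS ZARISKI DENSE IN `GL_n(ℂ)` (identities in the entries AND `det⁻¹`),
# and the transfer `IsUnitaryInvariant f → IsGLInvariant f` for the (E-a0) substitution action (`Theorems/K2LiuUnitaryZariskiDensity.lean`)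

Cell `hodgecm-mathlib`, crux item hLiu418 = `stmt-HodgeConjecture-24832`, route of record `HCCMUnconditional`; squad K2 ∕ K2Liu, road `K2_Liu`, socket #42F′,
FACE-G ∕ organ F4 (G-gen); F4 lead K2Liu-p27 (g2) (M-158s verdict (E), 2026-09-04T23:03:11Z), (E-a0) author K2E1-p10 (g4) (★ p862895, target head named
23:08:03Z: «`∀ f, IsUnitaryInvariant f → IsGLInvariant f`»), desk K2E5-r02 (g6) (typing note 23:06:04Z: «the `y`-leg is `y ↦ y·g⁻ᵀ`, NOT polynomial in `g` —
clear the denominator first»).  THEOREMS ONLY (no `def`, no `instance`, no `notation`, no named-fact hypothesis, no `sorry`); lane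
`--supports stmt-HodgeConjecture-24832` (count-neutral helper).

WHY.  Road (E) STEP 1 starts from `K_H = U(p) × U(q)`-invariant vectors of the Fock model, i.e. from `U(p)`-INVARIANT polynomials in two vectors and two
covectors (★ (E-a0) `IsUnitaryInvariant`), while the first fundamental theorem ((E-a2) `K2LiuUnitaryFFTContractionsTwo`, K2Liu-p23) is stated — and is only
true as a polynomial-identity argument — for `GL_p`-INVARIANCE (★ (E-a0) `IsGLInvariant`).  The bridge is Weyl's unitarian trick.  The substitution
`σ_g` (`x ↦ x·g`, `y ↦ y·(g⁻¹)ᵀ`) is polynomial in the entries of `g` and of `g⁻¹ = det(g)⁻¹ · adj(g)` — NOT polynomial in `g` alone — so the Zariski density of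
`U(p)` in `M_p(ℂ)` (★ `Literature.RepresentationTheory.AlgebraicGroups.mvPolynomial_eq_zero_of_eval_unitaryGroup`) must be upgraded to density in the affine
variety `GL_p(ℂ) = {(g, z) : z · det g = 1}`, whose regular functions are polynomials in the entries and in `z = det⁻¹`.  THIS FILE:
* §1 **`eval₂_eq_zero_of_eval₂_unitaryGroup`** — `U(n)` IS ZARISKI DENSE IN `GL_n(ℂ)`: a one-variable polynomial `G ∈ ℂ[X_{ij}][z]` with
  `G(U, det U⁻¹) = 0` for every unitary `U` satisfies `G(B, det B⁻¹) = 0` for every `B` with `det B ≠ 0`.  Proof: with `d := natDegree G`, the honest polynomial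
  `Q := Σ_{k ≤ d} (coeff_k G) · det(X)^{d−k} ∈ ℂ[X_{ij}]` has `Q(B) = det(B)^d · G(B, det B⁻¹)` whenever `det B ≠ 0`, so `Q` vanishes on `U(n)`, hence `Q = 0` by ★
  density in `M_n(ℂ)`, hence `G(B, det B⁻¹) = 0` (`det(B)^d ≠ 0`).
* §2 **`map_aeval_twoMatrixSubst`** — functoriality of the two-matrix substitution `x_{ia} ↦ Σ_b x_{ib} M_{ba}`, `y_{ja} ↦ Σ_b y_{jb} N_{ab}` (entries in any
  commutative `ℂ`-algebra `L`) under ring maps `L → L′` over `ℂ` (`MvPolynomial.map_aeval`); **`polySubst_eq_aeval_twoMatrixSubst`** — ★ (E-a0)'s `polySubst g` is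
  the instance `M := g`, `N := g⁻¹`.
* §3 **`isGLInvariant_of_isUnitaryInvariant`** — for EVERY `f` (no bidegree hypothesis): `IsUnitaryInvariant f → IsGLInvariant f`.  Proof: coefficientwise; the
  generic substitution with `M := X` (the generic matrix, ★ `Matrix.mvPolynomialX`) and `N := z • adj(X)` over `L := ℂ[X_{ij}][z]` specialises under
  `(X, z) ↦ (g, det g⁻¹)` to `polySubst g` (`g⁻¹ = det(g)⁻¹ • adj g`, `Matrix.inv_def`), so each coefficient of `polySubst g f − f` is `G_m(g, det g⁻¹)` for a fixed
  `G_m ∈ ℂ[X_{ij}][z]`, and §1 applies.  Corollary **`isGLInvariant_iff_isUnitaryInvariant`**.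
References: [Weyl1939] H. Weyl, *The Classical Groups* (1939), Ch. VIII §11 (the unitarian trick); [GoodmanWallachGTM255] R. Goodman, N. R. Wallach,
*Symmetry, Representations, and Invariants*, GTM 255 (2009), Thm. 11.5.10 (a compact real form is Zariski dense in the connected reductive group; here
`G = GL(n, ℂ)`, `U = U(n)`) and §3.3.4.
HONEST LABEL.  Count-neutral helper; it retires nothing by itself: `HC_CM` is proved only modulo the 7 printed citations (2 remaining named inputs:
hLiu418 = `stmt-HodgeConjecture-24832`, h413 = `stmt-HodgeConjecture-24833`) until rung 0 closes.

## Tree search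
★ `Literature/RepresentationTheory/AlgebraicGroups/UnitaryZariskiDense.lean` (`mvPolynomial_eq_zero_of_eval_unitaryGroup`, `eval_eq_of_eval_eq_on_unitaryGroup` —
density in `M_n(ℂ)`, no `det⁻¹`); ★ `Literature/InvariantTheory/…/TensorActionReynolds.aeval_tensorAct_eq_of_specialUnitaryGroup_invariant` (the `SU → SL` template,
no inverse leg); Mathlib `Matrix.mvPolynomialX`, `Matrix.mvPolynomialX_mapMatrix_eval`, `RingHom.map_adjugate`, `RingHom.map_det`, `Matrix.inv_def`,
`Matrix.coe_units_inv`, `Matrix.isUnits_det_units`, `Matrix.UnitaryGroup.det_isUnit`, `MvPolynomial.map_aeval`, `MvPolynomial.coeff_map`,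
`Polynomial.eval₂_eq_sum_range`.  Dedup `rg "isGLInvariant_of_isUnitaryInvariant|eval₂_eq_zero_of_eval₂_unitaryGroup"` over `lean/` = ∅.
-/

set_option autoImplicit false
set_option linter.dupNamespace false -- the mandated namespace repeats `HodgeConjecture.HodgeConjecture`

noncomputable section

open MvPolynomial Matrix
open Literature.RepresentationTheory.AlgebraicGroups
open Summit.HodgeConjecture.HodgeConjecture.Cruxes.HLiu418.K2LiuUnitaryPolySubstDefs

namespace Summit.HodgeConjecture.HodgeConjecture.Cruxes.HLiu418.K2LiuUnitaryZariskiDensity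

/-! ## §1 `U(n)` is Zariski dense in `GL_n(ℂ)`: polynomial identities in the entries and `det⁻¹` -/

/-- **`U(n)` IS ZARISKI DENSE IN `GL_n(ℂ)`** (the unitarian trick for the affine variety `{z · det = 1}`): a polynomial `G ∈ ℂ[X_{ij}][z]` with
`G(U, (det U)⁻¹) = 0` for every unitary `U` satisfies `G(B, (det B)⁻¹) = 0` for every complex matrix `B` with `det B ≠ 0`.  (With `d := natDegree G`, the matrix
polynomial `Q := Σ_{k ≤ d} coeff_k G · det(X)^{d-k}` has `Q(B) = det(B)^d · G(B, det B⁻¹)`; it vanishes on `U(n)`, hence identically by ★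
`mvPolynomial_eq_zero_of_eval_unitaryGroup`.) [cite: GoodmanWallachGTM255, Thm. 11.5.10] [cite: Weyl1939, Ch. VIII §11] -/
theorem eval₂_eq_zero_of_eval₂_unitaryGroup {n : Type*} [Fintype n] [DecidableEq n] (G : Polynomial (MvPolynomial (n × n) ℂ))
    (hG : ∀ U : Matrix n n ℂ, U ∈ Matrix.unitaryGroup n ℂ → G.eval₂ (MvPolynomial.eval fun q : n × n => U q.1 q.2) (U.det)⁻¹ = 0)
    (B : Matrix n n ℂ) (hB : B.det ≠ 0) : G.eval₂ (MvPolynomial.eval fun q : n × n => B q.1 q.2) (B.det)⁻¹ = 0 := by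
  classical
  set d : ℕ := G.natDegree with hd_def
  set Q : MvPolynomial (n × n) ℂ := ∑ k ∈ Finset.range (d + 1), G.coeff k * (mvPolynomialX n n ℂ).det ^ (d - k) with hQ_def
  -- `Q(C) = det(C)^d · G(C, det C⁻¹)` whenever `det C ≠ 0`
  have hQ : ∀ C : Matrix n n ℂ, C.det ≠ 0 →
      MvPolynomial.eval (fun q : n × n => C q.1 q.2) Q = C.det ^ d * G.eval₂ (MvPolynomial.eval fun q : n × n => C q.1 q.2) (C.det)⁻¹ := by
    intro C hC
    have hdet : MvPolynomial.eval (fun q : n × n => C q.1 q.2) (mvPolynomialX n n ℂ).det = C.det := by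
      rw [RingHom.map_det, mvPolynomialX_mapMatrix_eval]
    rw [Polynomial.eval₂_eq_sum_range, ← hd_def, Finset.mul_sum, hQ_def, map_sum]
    refine Finset.sum_congr rfl fun k hk => ?_
    have hk' : k ≤ d := Nat.lt_succ_iff.mp (Finset.mem_range.mp hk)
    rw [map_mul, map_pow, hdet, ← pow_sub_mul_pow C.det hk', inv_pow, mul_assoc, mul_left_comm (C.det ^ k), mul_inv_cancel₀ (pow_ne_zero k hC),
      mul_one, mul_comm]
  have hQU : ∀ U : Matrix n n ℂ, U ∈ Matrix.unitaryGroup n ℂ → MvPolynomial.eval (fun q : n × n => U q.1 q.2) Q = 0 := by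
    intro U hU
    have hUdet : U.det ≠ 0 := (Matrix.UnitaryGroup.det_isUnit (⟨U, hU⟩ : Matrix.unitaryGroup n ℂ)).ne_zero
    rw [hQ U hUdet, hG U hU, mul_zero]
  have hQ0 : Q = 0 := mvPolynomial_eq_zero_of_eval_unitaryGroup Q hQU
  have h := hQ B hB
  rw [hQ0, map_zero] at h
  exact (mul_eq_zero.mp h.symm).resolve_left (pow_ne_zero d hB)

/-! ## §2 The two-matrix substitution `x ↦ x·M`, `y ↦ y·Nᵀ` and its functoriality -/

variable {p : ℕ}

/-- **FUNCTORIALITY OF THE TWO-MATRIX SUBSTITUTION** `x_{ia} ↦ Σ_b x_{ib} M_{ba}`, `y_{ja} ↦ Σ_b y_{jb} N_{ab}` (entries of `M, N` in a commutative `ℂ`-algebra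
`L`): a ring map `φ : L → L′` compatible with `ℂ` carries the substituted polynomial to the polynomial substituted with `φ(M), φ(N)` (`MvPolynomial.map_aeval`).
[folklore] -/
theorem map_aeval_twoMatrixSubst {L L' : Type*} [CommRing L] [CommRing L'] [Algebra ℂ L] [Algebra ℂ L'] (φ : L →+* L')
    (hφ : φ.comp (algebraMap ℂ L) = algebraMap ℂ L') (M N : Matrix (Fin p) (Fin p) L) (f : MvPolynomial ((Fin 2 × Fin p) ⊕ (Fin 2 × Fin p)) ℂ) :
    MvPolynomial.map φ (aeval (Sum.elim
        (fun ia : Fin 2 × Fin p => ∑ b, (X (Sum.inl (ia.1, b)) : MvPolynomial ((Fin 2 × Fin p) ⊕ (Fin 2 × Fin p)) L) * C (M b ia.2))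
        (fun ja : Fin 2 × Fin p => ∑ b, (X (Sum.inr (ja.1, b)) : MvPolynomial ((Fin 2 × Fin p) ⊕ (Fin 2 × Fin p)) L) * C (N ja.2 b))) f) =
      aeval (Sum.elim
        (fun ia : Fin 2 × Fin p => ∑ b, (X (Sum.inl (ia.1, b)) : MvPolynomial ((Fin 2 × Fin p) ⊕ (Fin 2 × Fin p)) L') * C ((M.map φ) b ia.2))
        (fun ja : Fin 2 × Fin p => ∑ b, (X (Sum.inr (ja.1, b)) : MvPolynomial ((Fin 2 × Fin p) ⊕ (Fin 2 × Fin p)) L') * C ((N.map φ) ja.2 b))) f := by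
  have hA : (MvPolynomial.map φ).comp (algebraMap ℂ (MvPolynomial ((Fin 2 × Fin p) ⊕ (Fin 2 × Fin p)) L)) =
      algebraMap ℂ (MvPolynomial ((Fin 2 × Fin p) ⊕ (Fin 2 × Fin p)) L') := by
    refine RingHom.ext fun c => ?_
    have hc : φ (algebraMap ℂ L c) = algebraMap ℂ L' c := RingHom.congr_fun hφ c
    rw [RingHom.comp_apply, MvPolynomial.algebraMap_apply, MvPolynomial.algebraMap_apply, map_C, hc]
  have hg : (fun v => MvPolynomial.map φ ((Sum.elim
        (fun ia : Fin 2 × Fin p => ∑ b, (X (Sum.inl (ia.1, b)) : MvPolynomial ((Fin 2 × Fin p) ⊕ (Fin 2 × Fin p)) L) * C (M b ia.2))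
        (fun ja : Fin 2 × Fin p => ∑ b, (X (Sum.inr (ja.1, b)) : MvPolynomial ((Fin 2 × Fin p) ⊕ (Fin 2 × Fin p)) L) * C (N ja.2 b))) v)) =
      Sum.elim
        (fun ia : Fin 2 × Fin p => ∑ b, (X (Sum.inl (ia.1, b)) : MvPolynomial ((Fin 2 × Fin p) ⊕ (Fin 2 × Fin p)) L') * C ((M.map φ) b ia.2))
        (fun ja : Fin 2 × Fin p => ∑ b, (X (Sum.inr (ja.1, b)) : MvPolynomial ((Fin 2 × Fin p) ⊕ (Fin 2 × Fin p)) L') * C ((N.map φ) ja.2 b)) := by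
    funext v
    rcases v with ⟨i, a⟩ | ⟨j, a⟩
    · simp only [Sum.elim_inl, map_sum, map_mul, map_X, map_C, Matrix.map_apply]
    · simp only [Sum.elim_inr, map_sum, map_mul, map_X, map_C, Matrix.map_apply]
  rw [MvPolynomial.map_aeval, hA, hg, MvPolynomial.coe_eval₂Hom, ← MvPolynomial.aeval_def]

/-- **★ (E-a0)'s `polySubst g` IS THE TWO-MATRIX SUBSTITUTION AT `M := g`, `N := g⁻¹`** (`substFun g` unfolded; the matrix of `N` is `↑(g⁻¹) = (↑g)⁻¹`,
`Matrix.coe_units_inv`). [folklore] -/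
theorem polySubst_eq_aeval_twoMatrixSubst (g : GL (Fin p) ℂ) (f : MvPolynomial ((Fin 2 × Fin p) ⊕ (Fin 2 × Fin p)) ℂ) :
    polySubst g f = aeval (Sum.elim
        (fun ia : Fin 2 × Fin p => ∑ b, (X (Sum.inl (ia.1, b)) : MvPolynomial ((Fin 2 × Fin p) ⊕ (Fin 2 × Fin p)) ℂ) * C ((g : Matrix (Fin p) (Fin p) ℂ) b ia.2))
        (fun ja : Fin 2 × Fin p => ∑ b, (X (Sum.inr (ja.1, b)) : MvPolynomial ((Fin 2 × Fin p) ⊕ (Fin 2 × Fin p)) ℂ) *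
          C (((g⁻¹ : GL (Fin p) ℂ) : Matrix (Fin p) (Fin p) ℂ) ja.2 b))) f := by
  have hτ : (Sum.elim
        (fun ia : Fin 2 × Fin p => ∑ b, (X (Sum.inl (ia.1, b)) : MvPolynomial ((Fin 2 × Fin p) ⊕ (Fin 2 × Fin p)) ℂ) * C ((g : Matrix (Fin p) (Fin p) ℂ) b ia.2))
        (fun ja : Fin 2 × Fin p => ∑ b, (X (Sum.inr (ja.1, b)) : MvPolynomial ((Fin 2 × Fin p) ⊕ (Fin 2 × Fin p)) ℂ) *
          C (((g⁻¹ : GL (Fin p) ℂ) : Matrix (Fin p) (Fin p) ℂ) ja.2 b))) = substFun g := by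
    funext v
    rcases v with ⟨i, a⟩ | ⟨j, a⟩
    · rfl
    · rfl
  rw [hτ]
  rfl

/-! ## §3 The unitarian trick for the substitution action: `U(p)`-invariant ⇒ `GL_p(ℂ)`-invariant -/

/-- **THE UNITARIAN TRICK IN THE (E-a0) CURRENCY**: a polynomial in two vectors and two covectors which is invariant under the substitution action of
`U(p)` (`x ↦ x·u`, `y ↦ y·ū`) is invariant under all of `GL_p(ℂ)` (`x ↦ x·g`, `y ↦ y·(g⁻¹)ᵀ`) — for EVERY `f`, no bidegree hypothesis.  Coefficientwise:
with the generic matrix `X` and `N := z • adj X` over `ℂ[X_{ij}][z]`, each coefficient of `σ_g f − f` is `G_m(g, det g⁻¹)` for a fixed `G_m` (§2 and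
`g⁻¹ = det(g)⁻¹ • adj g`), and `G_m` vanishes at `(u, det u⁻¹)` for unitary `u`; conclude by §1. [cite: Weyl1939, Ch. VIII §11] [cite: GoodmanWallachGTM255, Thm. 11.5.10] -/
theorem isGLInvariant_of_isUnitaryInvariant {f : MvPolynomial ((Fin 2 × Fin p) ⊕ (Fin 2 × Fin p)) ℂ} (hf : IsUnitaryInvariant f) :
    IsGLInvariant f := by
  classical
  intro g
  rw [← sub_eq_zero]
  refine MvPolynomial.ext _ _ fun m => ?_
  rw [coeff_zero]
  -- the generic objects over `T := ℂ[X_{ij}][z]`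
  set MT : Matrix (Fin p) (Fin p) (Polynomial (MvPolynomial (Fin p × Fin p) ℂ)) := (mvPolynomialX (Fin p) (Fin p) ℂ).map Polynomial.C with hMT_def
  set NT : Matrix (Fin p) (Fin p) (Polynomial (MvPolynomial (Fin p × Fin p) ℂ)) := (Polynomial.X : (Polynomial (MvPolynomial (Fin p × Fin p) ℂ))) • ((mvPolynomialX (Fin p) (Fin p) ℂ).adjugate).map Polynomial.C with hNT_def
  set ET : MvPolynomial ((Fin 2 × Fin p) ⊕ (Fin 2 × Fin p)) (Polynomial (MvPolynomial (Fin p × Fin p) ℂ)) := aeval (Sum.elim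
        (fun ia : Fin 2 × Fin p => ∑ b, (X (Sum.inl (ia.1, b)) : MvPolynomial ((Fin 2 × Fin p) ⊕ (Fin 2 × Fin p)) (Polynomial (MvPolynomial (Fin p × Fin p) ℂ))) * C (MT b ia.2))
        (fun ja : Fin 2 × Fin p => ∑ b, (X (Sum.inr (ja.1, b)) : MvPolynomial ((Fin 2 × Fin p) ⊕ (Fin 2 × Fin p)) (Polynomial (MvPolynomial (Fin p × Fin p) ℂ))) * C (NT ja.2 b))) f -
      MvPolynomial.map (algebraMap ℂ (Polynomial (MvPolynomial (Fin p × Fin p) ℂ))) f with hET_def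
  set G : (Polynomial (MvPolynomial (Fin p × Fin p) ℂ)) := coeff m ET with hG_def
  -- KEY: `G(g′, det g′⁻¹) = coeff_m (σ_{g′} f − f)` for every `g′ ∈ GL_p(ℂ)`
  have key : ∀ g' : GL (Fin p) ℂ, G.eval₂ (MvPolynomial.eval fun q : Fin p × Fin p => (g' : Matrix (Fin p) (Fin p) ℂ) q.1 q.2)
      ((g' : Matrix (Fin p) (Fin p) ℂ).det)⁻¹ = coeff m (polySubst g' f - f) := by
    intro g'
    set ψ : (Polynomial (MvPolynomial (Fin p × Fin p) ℂ)) →+* ℂ := Polynomial.eval₂RingHom (MvPolynomial.eval fun q : Fin p × Fin p => (g' : Matrix (Fin p) (Fin p) ℂ) q.1 q.2)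
      ((g' : Matrix (Fin p) (Fin p) ℂ).det)⁻¹ with hψ_def
    have hψC : ψ.comp (algebraMap ℂ (Polynomial (MvPolynomial (Fin p × Fin p) ℂ))) = algebraMap ℂ ℂ := by
      ext c
      rw [RingHom.comp_apply, hψ_def, Polynomial.coe_eval₂RingHom, Polynomial.algebraMap_apply, Polynomial.eval₂_C, MvPolynomial.algebraMap_eq,
        MvPolynomial.eval_C, Algebra.algebraMap_self, RingHom.id_apply]
    have hM : MT.map ψ = (g' : Matrix (Fin p) (Fin p) ℂ) := by
      ext i j
      rw [Matrix.map_apply, hMT_def, Matrix.map_apply, mvPolynomialX_apply, hψ_def, Polynomial.coe_eval₂RingHom, Polynomial.eval₂_C, MvPolynomial.eval_X]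
    have hadj : ((mvPolynomialX (Fin p) (Fin p) ℂ).adjugate).map (MvPolynomial.eval fun q : Fin p × Fin p => (g' : Matrix (Fin p) (Fin p) ℂ) q.1 q.2) =
        (g' : Matrix (Fin p) (Fin p) ℂ).adjugate := by
      rw [← RingHom.mapMatrix_apply, RingHom.map_adjugate, mvPolynomialX_mapMatrix_eval]
    have hN : NT.map ψ = ((g'⁻¹ : GL (Fin p) ℂ) : Matrix (Fin p) (Fin p) ℂ) := by
      rw [Matrix.coe_units_inv, Matrix.inv_def, Ring.inverse_eq_inv, ← hadj]
      ext i j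
      rw [Matrix.map_apply, hNT_def, Matrix.smul_apply, Matrix.map_apply, Matrix.smul_apply, Matrix.map_apply, smul_eq_mul, smul_eq_mul, map_mul, hψ_def,
        Polynomial.coe_eval₂RingHom, Polynomial.eval₂_X, Polynomial.eval₂_C]
    have hcoeff : ψ G = coeff m (MvPolynomial.map ψ ET) := by
      rw [hG_def, coeff_map]
    rw [← Polynomial.coe_eval₂RingHom, ← hψ_def, hcoeff, hET_def, map_sub, map_aeval_twoMatrixSubst ψ hψC MT NT f, hM, hN, MvPolynomial.map_map, hψC,
      Algebra.algebraMap_self, MvPolynomial.map_id, ← polySubst_eq_aeval_twoMatrixSubst g' f]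
  -- §1 applies to `G`: it vanishes at `(u, det u⁻¹)` for unitary `u` by `hf`
  have hGU : ∀ U : Matrix (Fin p) (Fin p) ℂ, U ∈ Matrix.unitaryGroup (Fin p) ℂ →
      G.eval₂ (MvPolynomial.eval fun q : Fin p × Fin p => U q.1 q.2) (U.det)⁻¹ = 0 := by
    intro U hU
    have h := key (Unitary.toUnits (⟨U, hU⟩ : Matrix.unitaryGroup (Fin p) ℂ))
    rw [hf ⟨U, hU⟩, sub_self, coeff_zero] at h
    exact h
  have h := eval₂_eq_zero_of_eval₂_unitaryGroup G hGU (g : Matrix (Fin p) (Fin p) ℂ) (Matrix.isUnits_det_units g).ne_zero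
  rwa [key g] at h

/-- **`GL_p(ℂ)`-INVARIANCE ⇔ `U(p)`-INVARIANCE** for the substitution action on `ℂ[x_{ia}, y_{ja}]`. [cite: Weyl1939, Ch. VIII §11] -/
theorem isGLInvariant_iff_isUnitaryInvariant (f : MvPolynomial ((Fin 2 × Fin p) ⊕ (Fin 2 × Fin p)) ℂ) :
    IsGLInvariant f ↔ IsUnitaryInvariant f :=
  ⟨IsGLInvariant.isUnitaryInvariant, isGLInvariant_of_isUnitaryInvariant⟩

end Summit.HodgeConjecture.HodgeConjecture.Cruxes.HLiu418.K2LiuUnitaryZariskiDensity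

end
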